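import Literature.Computability.Cryptography.SNP
import HarnessLib

/-!
# Existential second-order logic on finite relational structures and Fagin's theorem `∃SO = NP`

Topic `Literature/ModelTheory/FiniteModelTheory`; definition request `wi-03767` (route
PneNP/Descriptive), companion of `Literature.Computability.Cryptography.SNPFormula` (`SNP.lean`), whose relational
vocabularies (`relLanguage ar`, an arity list `ar`), finite structures-as-tables (`RelTables`,
`structureOfTables`, `SNPInstance ar = Σ n, RelTables ar n`) and Boolean encoding
(`encodingSNPInstance`, via `encodingRelTables`) we REUSE verbatim.

* `ESOSentence ar` — `∃ S₁ … S_m ψ` over the input vocabulary `ar`: a list of witness arities and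
  a first-order sentence `ψ` (Mathlib `FirstOrder.Language.Sentence`) over the joint vocabulary
  `relLanguage ar ⊕ relLanguage witnessArities` (Mathlib `Language.sum`); this is `SNPFormula`
  with the universal-first-order restriction DROPPED (Fagin 1974, §2).
* `Holds` / `HoldsOnTables` (`∃` witness structure, Mathlib `Sentence.Realize` on the
  `sumStructure`), `modelClass`, `language` (codes of the finite models, `Encoding.toLanguage`),
  `ofSNP` (every SNP formula is an ESO sentence, same language).
* `relabelTables`, `IsIsoClosedStr` (closure of a class of finite `ar`-structures under
  relabelling the universe `Fin n` by a permutation — isomorphism of structures with universe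
  `Fin n`; different `n` are never isomorphic), `IsESODefinable ar C`.
* Named fact `fagin_theorem` (Fagin 1974, main theorem; Immerman 1999, Thm. 7.8): over a
  NON-DEGENERATE vocabulary (`IsNondegenerateVocab`: some arity `≥ 1`, so codes have length `≥ n`
  — for all-zero arity lists the binary size field makes `∃SO` = spectra = `NE`, and the statement
  would be false, review of p3103), a class of finite structures closed under isomorphism is
  `∃SO`-definable iff its set of codes is in `NP` (`Literature.Computability.Complexity.Nondeterministic.NP`). Nothing asserted.

## References

* R. Fagin, *Generalized first-order spectra and polynomial-time recognizable sets*, in: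
  Complexity of Computation, SIAM–AMS Proc. 7 (1974) 43–73 (main theorem: `∃SO = NP` on finite
  structures).
* L. Libkin, *Elements of Finite Model Theory* (2004), Ch. 9 (Fagin’s theorem);
  N. Immerman, *Descriptive Complexity* (1999), Thm. 7.8.
-/

namespace Literature.ModelTheory.FiniteModelTheory

open _root_.Computability Literature.Computability.Complexity Literature.Computability.Complexity.Nondeterministic Literature.Computability.Cryptography

/-! ### ESO sentences and their semantics -/

/-- **An existential second-order sentence** `∃ S₁ … S_m ψ` over the relational input vocabulary
with arity list `ar`: the arities of the quantified relations `S̄` and a first-order sentence `ψ`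
over inputs and witnesses (Mathlib `FirstOrder.Language.sum`, `Sentence`). [Fagin 1974, §2
(generalized spectra / `∃SO`)] [cite: Fagin1974, §2] -/
structure ESOSentence (ar : List ℕ) where
  /-- Arities of the second-order existentially quantified relation symbols `S₁, …, S_m`. -/
  witnessArities : List ℕ
  /-- The first-order part, a sentence over inputs and witnesses. -/
  sentence : ((relLanguage ar).sum (relLanguage witnessArities)).Sentence

namespace ESOSentence

variable {ar : List ℕ}

/-- Semantics on an input structure `M`: SOME interpretation of the witness relations makes the
joint structure satisfy `ψ`. [Fagin 1974, §2] [cite: Fagin1974, §2] -/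
def Holds (Φ : ESOSentence ar) (M : Type) [(relLanguage ar).Structure M] : Prop :=
  ∃ S : (relLanguage Φ.witnessArities).Structure M,
    @FirstOrder.Language.Sentence.Realize _ M
      (@FirstOrder.Language.sumStructure _ _ M _ S) Φ.sentence

/-- Semantics on a finite input given by Boolean tables on `Fin n`. [Fagin 1974, §2] [cite: Fagin1974, §2] -/
def HoldsOnTables (Φ : ESOSentence ar) (n : ℕ) (R : RelTables ar n) : Prop :=
  letI := structureOfTables R
  Φ.Holds (Fin n)

/-- Unfolding: `Φ` holds on `R` iff some Boolean witness TABLES work (witness structures on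
`Fin n` are tables). [Fagin 1974, §2] [folklore] -/
theorem holdsOnTables_iff (Φ : ESOSentence ar) (n : ℕ) (R : RelTables ar n) :
    Φ.HoldsOnTables n R ↔ ∃ W : RelTables Φ.witnessArities n,
      @FirstOrder.Language.Sentence.Realize _ (Fin n)
        (@FirstOrder.Language.sumStructure _ _ (Fin n) (structureOfTables R)
          (structureOfTables W)) Φ.sentence := by
  refine ⟨?_, fun ⟨W, hW⟩ => ⟨structureOfTables W, hW⟩⟩
  rintro ⟨S, hS⟩
  refine ⟨tablesOfStructure S, ?_⟩
  rwa [structureOfTables_tablesOfStructure]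

/-- The class of finite models `{⟨n, R⟩ | ⟨Fin n, R⟩ ⊨ Φ}`. [Fagin 1974, §2 (generalized
spectrum)] [cite: Fagin1974, §2] -/
def modelClass (Φ : ESOSentence ar) : Set (SNPInstance ar) :=
  {x | Φ.HoldsOnTables x.1 x.2}

/-- The language of codes of the finite models of `Φ` (table encoding `encodingSNPInstance`).
[Fagin 1974, §3 (structures as strings)] [cite: Fagin1974, §3] -/
def language (Φ : ESOSentence ar) : Language Bool :=
  (encodingSNPInstance ar).toLanguage Φ.modelClass

/-- Every SNP formula is an ESO sentence (forget universality). [Papadimitriou–Yannakakis 1991,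
§2 (SNP ⊆ ∃SO)] [folklore] -/
def ofSNP (Ψ : SNPFormula) : ESOSentence Ψ.inputArities :=
  ⟨Ψ.witnessArities, Ψ.sentence⟩

/-- … with the same semantics, [folklore] -/
theorem holdsOnTables_ofSNP (Ψ : SNPFormula) (n : ℕ) (R : RelTables Ψ.inputArities n) :
    (ofSNP Ψ).HoldsOnTables n R ↔ Ψ.HoldsOnTables n R :=
  Iff.rfl

/-- … hence the same language. [folklore] -/
theorem language_ofSNP (Ψ : SNPFormula) : (ofSNP Ψ).language = Ψ.language :=
  rfl

/-- Membership of a codeword in `Φ.language` is `HoldsOnTables`. [folklore] -/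
@[simp] theorem encode_mem_language_iff (Φ : ESOSentence ar) (x : SNPInstance ar) :
    (encodingSNPInstance ar).encode x ∈ Φ.language ↔ Φ.HoldsOnTables x.1 x.2 :=
  Encoding.mem_toLanguage_iff _ _ _

end ESOSentence

/-! ### Isomorphism-closed classes, definability, Fagin -/

/-- Relabel the universe `Fin n` of a table structure by a permutation `π` (the isomorphic copy
`π_* R`, `(π_* R)(v) = R(π⁻¹ ∘ v)`). [Fagin 1974, §2 (isomorphism-closed classes)] [folklore] -/
def relabelTables {ar : List ℕ} {n : ℕ} (R : RelTables ar n) (π : Equiv.Perm (Fin n)) :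
    RelTables ar n :=
  fun i v => R i (π.symm ∘ v)

/-- A class of finite `ar`-structures (universes `Fin n`) is ISOMORPHISM-CLOSED: invariant under
relabelling by permutations of `Fin n` (structures with different `n` are never isomorphic).
[Fagin 1974, §2] [folklore] -/
def IsIsoClosedStr (ar : List ℕ) (C : Set (SNPInstance ar)) : Prop :=
  ∀ (n : ℕ) (R : RelTables ar n) (π : Equiv.Perm (Fin n)), (⟨n, R⟩ ∈ C ↔ ⟨n, relabelTables R π⟩ ∈ C)

/-- **`∃SO`-definability** of a class of finite `ar`-structures. [Fagin 1974, §2 (generalized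
spectra)] [cite: Fagin1974, §2] -/
def IsESODefinable (ar : List ℕ) (C : Set (SNPInstance ar)) : Prop :=
  ∃ Φ : ESOSentence ar, Φ.modelClass = C

/-- The vocabulary is NON-DEGENERATE: some relation symbol has arity `≥ 1`. Then the table
encoding of an `n`-element structure has length `≥ n` (`tableBits ar n ≥ n`), the standard size
convention under which Fagin's theorem is stated; for all-zero arity lists the code of `⟨n, R⟩`
has length `O(log n)` (universe size in binary) and `∃SO` over such vocabularies defines exactly
the first-order SPECTRA (= `NE` in binary, Jones–Selman 1974), so the theorem would FAIL for them.
[Immerman 1999, §2.1 (`|bin(𝔄)| = n^{O(1)}`); Fagin 1974, §3] [folklore] -/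
def IsNondegenerateVocab (ar : List ℕ) : Prop :=
  ∃ k ∈ ar, 1 ≤ k

/-- NAMED FACT (**Fagin's theorem**; Fagin 1974, main theorem; Immerman 1999, Thm. 7.8;
Libkin 2004, Thm. 9.5): over a NON-DEGENERATE relational vocabulary (some arity `≥ 1`, so that
codes of `n`-element structures have length `≥ n`), a class of finite structures closed under
isomorphism is definable by an existential second-order sentence iff the language of its codes is
in `NP` (`Literature.Computability.Complexity.Nondeterministic.NP`, table encoding `encodingSNPInstance` with the universe size in
binary followed by the `Σᵢ n^{arᵢ} ≥ n` table bits). Users take `(h : fagin_theorem)`.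
[Fagin 1974, Thm. (§4); Immerman 1999, Thm. 7.8; Libkin 2004, Thm. 9.5] [cite: Immerman1999, Thm. 7.8] -/
def fagin_theorem : Prop :=
  ∀ (ar : List ℕ) (C : Set (SNPInstance ar)), IsNondegenerateVocab ar → IsIsoClosedStr ar C →
    (IsESODefinable ar C ↔ (encodingSNPInstance ar).toLanguage C ∈ NP)

/-! ### API -/

/-- Relabelling by the identity does nothing. [folklore] -/
@[simp] theorem relabelTables_one {ar : List ℕ} {n : ℕ} (R : RelTables ar n) :
    relabelTables R 1 = R := by
  funext i v; rfl

/-- Relabelling is an action: `relabel (relabel R π) τ = relabel R (τ * π)`. [folklore] -/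
theorem relabelTables_relabelTables {ar : List ℕ} {n : ℕ} (R : RelTables ar n)
    (π τ : Equiv.Perm (Fin n)) : relabelTables (relabelTables R π) τ = relabelTables R (τ * π) := by
  funext i v
  simp only [relabelTables, Equiv.Perm.mul_def]
  rfl

/-- The empty class and the class of all structures are isomorphism-closed. [folklore] -/
theorem isIsoClosedStr_univ (ar : List ℕ) : IsIsoClosedStr ar Set.univ := fun _ _ _ => by simp

/-- The class of all finite `ar`-structures is `∃SO`-definable (by `⊤` with no witnesses).
[Fagin 1974, §2] [folklore] -/
theorem isESODefinable_univ (ar : List ℕ) : IsESODefinable ar Set.univ := by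
  refine ⟨⟨[], ⊤⟩, Set.eq_univ_of_forall fun x => ?_⟩
  change ESOSentence.HoldsOnTables _ _ _
  rw [ESOSentence.holdsOnTables_iff]
  exact ⟨fun _ _ => false, by simp⟩

/-- Fagin, easy direction, for a given sentence with isomorphism-closed model class (all model
classes are; the closure is taken as a hypothesis here rather than proved by transport of
structure). [Fagin 1974, main theorem (⇒)] [folklore] -/
theorem ESOSentence.language_mem_NP (h : fagin_theorem) {ar : List ℕ} (har : IsNondegenerateVocab ar)
    (Φ : ESOSentence ar) (hiso : IsIsoClosedStr ar Φ.modelClass) : Φ.language ∈ NP :=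
  (h ar Φ.modelClass har hiso).1 ⟨Φ, rfl⟩

/-- Under non-degeneracy the code length dominates the universe size: `n ≤ tableBits ar n`
(for `n ≥ 1`; one table alone has `n^k ≥ n` bits). [Immerman 1999, §2.1] [folklore] -/
theorem le_tableBits_of_isNondegenerateVocab {ar : List ℕ} (har : IsNondegenerateVocab ar) (n : ℕ) :
    n ≤ tableBits ar n := by
  obtain ⟨k, hk, hk1⟩ := har
  obtain ⟨i, hi⟩ := List.mem_iff_get.1 hk
  rcases Nat.eq_zero_or_pos n with rfl | hn
  · exact Nat.zero_le _
  calc n = n ^ 1 := (pow_one n).symm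
    _ ≤ n ^ ar.get i := Nat.pow_le_pow_right hn (hi ▸ hk1)
    _ ≤ tableBits ar n := Finset.single_le_sum (f := fun j : Fin ar.length => n ^ ar.get j)
        (fun _ _ => Nat.zero_le _) (Finset.mem_univ i)

/-- The graph vocabulary `[2]` is non-degenerate. [folklore] -/
example : IsNondegenerateVocab [2] := ⟨2, by simp, by norm_num⟩

end Literature.ModelTheory.FiniteModelTheory
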